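import Summits.Ventures.CertifiedManyBodySolver.Observables.PhaseSeparationExclusionBox
import Literature.MathematicalPhysics.QuantumLattice.HubbardTTPrimeDiagHopTransport
import Literature.MathematicalPhysics.QuantumLattice.HubbardFermiSeaTangentRowsDiluteEDopedImageA
import Literature.MathematicalPhysics.QuantumLattice.HubbardFermiSeaTangentRowsDiluteEDopedImageB
import Literature.MathematicalPhysics.QuantumLattice.HubbardFermiSeaTangentRowsDiluteEDopedImageC
import HarnessLib
import HarnessLib.Audit

/-!
# Ventures/CertifiedManyBodySolver — Observables/PhaseSeparationExclusionEDopedFarColumns.lean: the COLUMNS and FLOORS of the competing-order words on the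
# FAR POSITIVE strip `t′ ∈ [9/20, 13/20]` (= the particle–hole images of the ELECTRON-DOPED object-E boxes NCCO / Nd₂CuO₄ / Sr₁₋ₓLaₓCuO₂, router `t′/t ∈ [−0.65, −0.46]`)

HONEST FRAMING: first certified bounds; not a superconductivity verdict. CLASS = TRANSPORT (§0) + DERIVED / CONTEXT (§1–§3). No new certificate, no CERTIFIED row, no
cell word of the meter's kind, no claim node, no MOVE. Seat hubbard-box-p3 g32 (`prover-hubbard-box-p3-g32-0`, tranche-2 S2 row «t′-direction Lipschitz … so t′-boxes
transport from anchors; joint/covering statements»), 2026-08-29; generator `pub/hubbard-fast/hubbard-box-p3/work-g32/ed/emit_cols.py` (exact `fractions`; decimals are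
10-dp DOWNWARD roundings).

WHY. The four electron-doped rows of the routed-box table (psbox v1.2: M20 NCCO-x0.15 `[−0.62,−0.51] × [2.4,3.2]`, M55 NCCO-x0.10, M56 Nd₂CuO₄ `[−0.562,−0.461] × [2.17,2.77]`,
M37 Sr₁₋ₓLaₓCuO₂ `[−0.649,−0.548] × [2.42,11.24]`, all `n > 1`) carried no competing-order sentence: their «(≤ 1 ∣ ≥ 2 − n₁)» pairs are the «(≤ n₁ ∣ ≥ 1)» pairs of the
SAME model at `−t′ ∈ [0.46, 0.65] > 0` (`ps_not_groundState_mix_particleHole_on_cell`, hubbard-downfold-unc-2 p703218), a strip nobody had worded (unc-2's electron-doped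
files g27/g28 are the object-M reading `|t′| ≤ 2/5`). This file supplies the three bound families the column-form cell law needs there:
* §0 DEVICES: `ps_not_groundState_mix_on_cell_of_spanColumns_tcap` (the cell `[U₁,U₂]` may sit INSIDE the span `[Ua,Ub]` of the two column laws — margins at `U₁`,
  `U₂` only); `sixteen_div_pi_sq_le_edK` (`16/π² ≤ 1.6212`); `n1_col_pos_kin_of_anchor` — the `t′`-LIPSCHITZ carry of a half-filling floor from a hole-side anchor `q`
  to every `s ≥ −q` with the kinematic constant (`HubbardTTPrimeDiagHopTransport.energyDensityTT'_ge_of_lowerBound_tPrime_kinematic` + evenness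
  `energyDensityTT'_particleHole_one`); `n1_col_pos_flat_of_anchor` / `n1_col_pos_chord_of_anchors` (evenness + monotonicity / concavity).
* §1 DILUTE FLOORS `edf_dilute{1o5,1o4,3o10,2o5,9o20}_{p45p55,p55p65}`: `t′`-chords of this seat's new PREMISE-FREE kernel Fermi-sea tangent rows at `t′ ∈ {9/20, 11/20, 13/20}`
  (`HubbardFermiSeaTangentRowsDiluteEDopedImage{A,B,C}` = `t′ ∈ {9/20, 11/20, 13/20}`, six rows each, four-corner `M = 64` cells, any `t′`).
* §2 FREE half-filled columns `edf_n1_col0_{seg}_atU` (kernel rows touching at `n₀ = 1`, valid at every `U₀ ≥ 0`).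
* §3 (companion file `…EDopedFarColumnsB.lean`) ANCHORED half-filled columns `edf_n1_col{7o2,5,8,10,12}_{seg}` BY EVENNESS from the hole-side rows already used by `…FarPlanes*` / `…FarPlanesBeyondHalf*` (box-eng-1
  XL sheets `hsX…m{40,45,50,55,60,65}` read at `m = 1`, fast-eng N-tier points `hN…`, BY VALUE as hypotheses): chords for `|t′| ≤ 11/20` and at `U ≥ 8`; at `U = 7/2, 5` beyond
  `|t′| = 11/20` (no `m55`-quality sheet) the `t′`-Lipschitz carry of the `−11/20` sheet (`−1.1069 → −1.2690` at `U = 7/2`, `−0.9261 → −1.0882` at `U = 5`, `t′ = 13/20`),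
  which beats both the `m65` sheets read at `m = 1` (`−1.288` at `U = 5`) and the `U`-chord through `U = 8`.
Cells, unions, mirrors and routed boxes: `…EDopedFarCells{A,B}.lean`, `…EDopedFarWords.lean`, `…RoutedBoxesF.lean`.
WHAT THIS IS NOT: a certificate; a statement about which phase is realised, about `T > 0`, or about superconductivity. Zero kit.
References: [Israel1979] Thm I.2.4 / I.3.4; [EmeryKivelsonLin1990]; [Ruelle1969] §3.3; [LiebLoss1993] §8 Thm 8.2; [LiebWuPhysicaA2003] §1 eq. (3); [Griffiths1966] §II.
-/

noncomputable section

namespace Summit.Ventures.CertifiedManyBodySolver.Observables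

open Literature.MathematicalPhysics.QuantumLattice Literature.MathematicalPhysics.QuantumLattice.ThermodynamicLimit
open Literature.MathematicalPhysics.QuantumLattice.InfVolFermionState Set

/-! ## §0 Devices: the span-columns cell law, the kinematic constant, the positive-side `n = 1` column carried from a hole-side anchor -/

/-- **PS EXCLUSION ON A SUB-CELL OF A COLUMN SPAN, `t′`-AFFINE CAP.** As `ps_not_groundState_mix_on_cell_of_columns_tcap`, but the two
column laws `L₁`, `L₂` at `n₂` sit at the ends `Ua < Ub` of a SPAN while the cell is `[s₁, s₂] × [U₁, U₂]` with `Ua ≤ U₁`, `U₂ ≤ Ub`: the `U`-chord of the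
two columns floors the whole span (`e` concave in `U`, `floor_on_cell_of_columnLaws`), the cap `c₀ + c_s s + c₁ U` and the dilute floor `F₁` are as before, and the
margin — affine in `U` at fixed `s` — is checked at the two cell ends `U₁`, `U₂` only (both written multiplied through by `Ub − Ua > 0`).
[cite: Israel1979, Thm. I.2.4] [cite: EmeryKivelsonLin1990, pp. 475–476] [cite: Ruelle1969, §3.3] -/
theorem ps_not_groundState_mix_on_cell_of_spanColumns_tcap (t : ℝ) {s₁ s₂ Ua Ub U₁ U₂ n₁ n₂ a b c₀ cs c₁ : ℝ}
    (hUa : 0 ≤ Ua) (hab' : Ua < Ub) (hU₁ : Ua ≤ U₁) (hU₂ : U₂ ≤ Ub) (hn₁ : 0 ≤ n₁) (hn : n₁ < n₂) (hn₂ : n₂ < 2)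
    (ha : 0 ≤ a) (hb : 0 ≤ b) (hab : a + b = 1) {L₁ L₂ F₁ : ℝ → ℝ}
    (hC : ∀ s ∈ Icc s₁ s₂, ∀ U ∈ Icc U₁ U₂, energyDensityTT' t s U (a * n₁ + b * n₂) ≤ c₀ + cs * s + c₁ * U)
    (hL₁ : ∀ s ∈ Icc s₁ s₂, L₁ s ≤ energyDensityTT' t s Ua n₂) (hL₂ : ∀ s ∈ Icc s₁ s₂, L₂ s ≤ energyDensityTT' t s Ub n₂)
    (hF₁ : ∀ s ∈ Icc s₁ s₂, ∀ U ∈ Icc U₁ U₂, F₁ s ≤ energyDensityTT' t s U n₁)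
    (hm₁ : ∀ s ∈ Icc s₁ s₂, 0 < (Ub - Ua) * (a * F₁ s) + b * ((Ub - U₁) * L₁ s + (U₁ - Ua) * L₂ s) - (Ub - Ua) * (c₀ + cs * s + c₁ * U₁))
    (hm₂ : ∀ s ∈ Icc s₁ s₂, 0 < (Ub - Ua) * (a * F₁ s) + b * ((Ub - U₂) * L₁ s + (U₂ - Ua) * L₂ s) - (Ub - Ua) * (c₀ + cs * s + c₁ * U₂))
    {s : ℝ} (hs : s ∈ Icc s₁ s₂) {U : ℝ} (hU : U ∈ Icc U₁ U₂)
    {ω₁ ω₂ : InfVolFermionState 2} (h₁ : ω₁.IsTranslationInvariant) (h₂ : ω₂.IsTranslationInvariant)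
    (hρ₁ : 0 < ω₁.density) (hρ₁' : ω₁.density ≤ n₁) (hρ₂ : n₂ ≤ ω₂.density) (hρ₂' : ω₂.density < 2)
    {lam : ℝ} (hl0 : 0 < lam) (hl1 : lam < 1) :
    energyDensityTT' t s U (mix lam hl0.le hl1.le ω₁ ω₂).density <
      (mix lam hl0.le hl1.le ω₁ ω₂).meanEnergy (hubbardTTPrimeFermionInteraction t s U) 1 := by
  have hn2' : 0 ≤ n₂ := hn₁.trans hn.le
  have hd : 0 < Ub - Ua := sub_pos.2 hab'
  refine ps_not_groundState_mix_on_cell_of_fns t (hUa.trans hU₁) hn ha hb hab (C := fun s U => c₀ + cs * s + c₁ * U)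
    (F₁ := fun s _ => F₁ s) (F₂ := fun s U => ((Ub - U) * L₁ s + (U - Ua) * L₂ s) / (Ub - Ua)) hC hF₁ ?_ ?_ hs hU
    h₁ h₂ hρ₁ hρ₁' hρ₂ hρ₂' hl0 hl1
  · intro s hs U hU
    exact floor_on_cell_of_columnLaws t hn2' hn₂ hUa hab' hL₁ hL₂ s hs U ⟨hU₁.trans hU.1, hU.2.trans hU₂⟩
  · intro s hs U hU
    have g1 := hm₁ s hs
    have g2 := hm₂ s hs
    set σ : ℝ := b * (L₂ s - L₁ s) - (Ub - Ua) * c₁ with hσ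
    have gU : 0 < (Ub - Ua) * (a * F₁ s) + b * ((Ub - U) * L₁ s + (U - Ua) * L₂ s) - (Ub - Ua) * (c₀ + cs * s + c₁ * U) := by
      rcases le_or_gt 0 σ with hp | hneg
      · have k : 0 ≤ (U - U₁) * σ := mul_nonneg (sub_nonneg.2 hU.1) hp
        have e : (Ub - Ua) * (a * F₁ s) + b * ((Ub - U) * L₁ s + (U - Ua) * L₂ s) - (Ub - Ua) * (c₀ + cs * s + c₁ * U) =
            ((Ub - Ua) * (a * F₁ s) + b * ((Ub - U₁) * L₁ s + (U₁ - Ua) * L₂ s) - (Ub - Ua) * (c₀ + cs * s + c₁ * U₁)) + (U - U₁) * σ := by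
          rw [hσ]; ring
        rw [e]; linarith
      · have k : 0 ≤ (U₂ - U) * (-σ) := mul_nonneg (sub_nonneg.2 hU.2) (by linarith)
        have e : (Ub - Ua) * (a * F₁ s) + b * ((Ub - U) * L₁ s + (U - Ua) * L₂ s) - (Ub - Ua) * (c₀ + cs * s + c₁ * U) =
            ((Ub - Ua) * (a * F₁ s) + b * ((Ub - U₂) * L₁ s + (U₂ - Ua) * L₂ s) - (Ub - Ua) * (c₀ + cs * s + c₁ * U₂)) + (U₂ - U) * (-σ) := by
          rw [hσ]; ring
        rw [e]; linarith
    have key : (c₀ + cs * s + c₁ * U - a * F₁ s) * (Ub - Ua) < b * ((Ub - U) * L₁ s + (U - Ua) * L₂ s) := by linarith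
    have h4 : c₀ + cs * s + c₁ * U - a * F₁ s < b * ((Ub - U) * L₁ s + (U - Ua) * L₂ s) / (Ub - Ua) := by
      rw [lt_div_iff₀ hd]; exact key
    have h5 : b * (((Ub - U) * L₁ s + (U - Ua) * L₂ s) / (Ub - Ua)) = b * ((Ub - U) * L₁ s + (U - Ua) * L₂ s) / (Ub - Ua) :=
      (mul_div_assoc _ _ _).symm
    show c₀ + cs * s + c₁ * U < a * F₁ s + b * (((Ub - U) * L₁ s + (U - Ua) * L₂ s) / (Ub - Ua))
    rw [h5]; linarith

/-- `16/π² ≤ 4053/2500 = 1.6212` (from `3.141592 < π`; `16/π² = 1.62113…`), the rational stand-in for the kinematic `t′`-Lipschitz constant of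
`energyDensityTT'_ge_of_lowerBound_tPrime_kinematic`. [cite: Israel1979, Thm. I.3.4] -/
theorem sixteen_div_pi_sq_le_edK : 16 / Real.pi ^ 2 ≤ (4053 / 2500 : ℝ) := by
  have hπ := Real.pi_gt_d6
  have h0 : (0 : ℝ) < 3.141592 := by norm_num
  have h2 : (3.141592 : ℝ) ^ 2 < Real.pi ^ 2 := by nlinarith
  rw [div_le_iff₀ (by positivity)]
  nlinarith

/-- **Positive-side half-filling column carried OUTWARD from a hole-side anchor** (the `t′`-LIPSCHITZ device): a floor `v ≤ e(t, q, U, 1)` at some `q`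
(in use: `q = −11/20`, a box-eng-1 XL sheet read at `m = 1`) gives, for every `s ≥ −q`, `v − (4053/2500)(s + q) ≤ e(t, s, U, 1)` — the kinematic law
`e(t,s',U,n) ≥ e(t,q,U,n) − (16/π²)|s' − q|` (`energyDensityTT'_ge_of_lowerBound_tPrime_kinematic`, half-filled diagonal-band constant) taken at `s' = −s` and
evenness `e(t, −s, U, 1) = e(t, s, U, 1)` (`energyDensityTT'_particleHole_one`). Affine in `s`; the `t′`-direction carry that words the e-doped boxes beyond `|t′| = 11/20`
at `U ≤ 5`, where no sheet of the `m55` quality exists. [cite: Israel1979, Thm. I.3.4] [cite: LiebWuPhysicaA2003, §1 eq. (3)] -/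
theorem n1_col_pos_kin_of_anchor (t : ℝ) {U : ℝ} (hU : 0 ≤ U) {q v : ℝ} (hv : v ≤ energyDensityTT' t q U 1) {s : ℝ} (hs : -q ≤ s) :
    v - (4053 / 2500 : ℝ) * (s + q) ≤ energyDensityTT' t s U 1 := by
  have h := energyDensityTT'_ge_of_lowerBound_tPrime_kinematic t hU zero_le_one one_lt_two (s' := -s) hv
  rw [energyDensityTT'_particleHole_one t s hU] at h
  have habs : |-s - q| = s + q := by
    rw [abs_of_nonpos (by linarith)]
    ring
  rw [habs] at h
  have hk : 16 / Real.pi ^ 2 * (s + q) ≤ (4053 / 2500 : ℝ) * (s + q) :=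
    mul_le_mul_of_nonneg_right sixteen_div_pi_sq_le_edK (by linarith)
  linarith

/-- **Positive-side half-filling column from a hole-side anchor FURTHER OUT** (evenness + monotonicity): a floor `v ≤ e(t, q, U, 1)` at `q ≤ 0` gives
`v ≤ e(t, s, U, 1)` for every `0 ≤ s ≤ −q` (`t′ ↦ e(t,t′,U,1)` is non-decreasing on `(−∞, 0]`, `monotoneOn_energyDensityTT'_tPrime_one`; then `e(t,−s,U,1) = e(t,s,U,1)`).
[cite: LiebWuPhysicaA2003, §1 eq. (3)] [cite: Israel1979, Thm. I.3.4] -/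
theorem n1_col_pos_flat_of_anchor (t : ℝ) {U : ℝ} (hU : 0 ≤ U) {q v : ℝ} (hq : q ≤ 0) (hv : v ≤ energyDensityTT' t q U 1)
    {s : ℝ} (hs0 : 0 ≤ s) (hs : s ≤ -q) : v ≤ energyDensityTT' t s U 1 := by
  have hm : energyDensityTT' t q U 1 ≤ energyDensityTT' t (-s) U 1 :=
    monotoneOn_energyDensityTT'_tPrime_one t hU (show q ∈ Iic (0 : ℝ) from hq)
      (show -s ∈ Iic (0 : ℝ) from by simpa using hs0) (by linarith)
  rw [energyDensityTT'_particleHole_one t s hU] at hm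
  exact hv.trans hm

/-- **Positive-side half-filling column from TWO hole-side anchors** (evenness + concavity in `t′`): floors `v₁ ≤ e(t, q₁, U, 1)`, `v₂ ≤ e(t, q₂, U, 1)` at
`q₁ < q₂` give, for every `s` with `−s ∈ [q₁, q₂]`, the chord `((q₂ + s) v₁ + (−s − q₁) v₂)/(q₂ − q₁) ≤ e(t, s, U, 1)` (`energyDensityTT'_tchord_floor_of_mem_Icc` at `−s`,
then `e(t,−s,U,1) = e(t,s,U,1)`). [cite: Ruelle1969, §3.3] [cite: LiebWuPhysicaA2003, §1 eq. (3)] -/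
theorem n1_col_pos_chord_of_anchors (t : ℝ) {U : ℝ} (hU : 0 ≤ U) {q₁ q₂ v₁ v₂ : ℝ} (h12 : q₁ < q₂)
    (hv₁ : v₁ ≤ energyDensityTT' t q₁ U 1) (hv₂ : v₂ ≤ energyDensityTT' t q₂ U 1) {s : ℝ} (hs₁ : q₁ ≤ -s) (hs₂ : -s ≤ q₂) :
    ((q₂ - -s) * v₁ + (-s - q₁) * v₂) / (q₂ - q₁) ≤ energyDensityTT' t s U 1 := by
  have h := energyDensityTT'_tchord_floor_of_mem_Icc t hU (n := 1) zero_le_one one_lt_two h12 hv₁ hv₂ (s := -s) ⟨hs₁, hs₂⟩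
  rwa [energyDensityTT'_particleHole_one t s hU] at h

/-! ## §1 Dilute floors on the two far positive segments (kernel Fermi-sea tangent rows, `t′`-chords; any density, every `U ≥ 0`) -/

/-- **Dilute floor on `t′ ∈ [9/20, 11/20]`, rows touching `1/5`** (any density `0 ≤ n₁ < 2`, every `U ≥ 0`): the `t′`-chord of the two PREMISE-FREE kernel
Fermi-sea tangent rows `fermiSeaTangentRow_tPrime_nine_div_twenty_at_one_div_five` and `fermiSeaTangentRow_tPrime_eleven_div_twenty_at_one_div_five` (`HubbardFermiSeaTangentRowsDiluteEDopedImage*`, this seat g32; floors at `n₁ = 1/5`: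
-0.9404596 ∣ -0.9979019). [cite: LiebLoss1993, §8, Theorem 8.2] [cite: Ruelle1969, §3.3] -/
theorem edf_dilute1o5_p45p55 {n₁ : ℝ} (hn0 : 0 ≤ n₁) (hn2 : n₁ < 2) :
    ∀ s ∈ Icc (9 / 20 : ℝ) (11 / 20), ∀ U : ℝ, 0 ≤ U →
      ((11 / 20 - s) * ((-0.1963678024 : ℝ) + (-15239 / 4096) * n₁) + (s - (9 / 20)) * ((-0.2281264663 : ℝ) + (-15765 / 4096) * n₁)) / (11 / 20 - (9 / 20)) ≤
        energyDensityTT' 1 s U n₁ :=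
  floor_on_cell_of_tPrime_end_rows 1 hn0 hn2 (by norm_num)
    (fun _ hU => fermiSeaTangentRow_tPrime_nine_div_twenty_at_one_div_five hU hn0 hn2)
    (fun _ hU => fermiSeaTangentRow_tPrime_eleven_div_twenty_at_one_div_five hU hn0 hn2)

/-- **Dilute floor on `t′ ∈ [9/20, 11/20]`, rows touching `1/4`** (any density `0 ≤ n₁ < 2`, every `U ≥ 0`): the `t′`-chord of the two PREMISE-FREE kernel
Fermi-sea tangent rows `fermiSeaTangentRow_tPrime_nine_div_twenty_at_one_div_four` and `fermiSeaTangentRow_tPrime_eleven_div_twenty_at_one_div_four` (`HubbardFermiSeaTangentRowsDiluteEDopedImage*`, this seat g32; floors at `n₁ = 1/4`: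
-1.1126356 ∣ -1.1784266). [cite: LiebLoss1993, §8, Theorem 8.2] [cite: Ruelle1969, §3.3] -/
theorem edf_dilute1o4_p45p55 {n₁ : ℝ} (hn0 : 0 ≤ n₁) (hn2 : n₁ < 2) :
    ∀ s ∈ Icc (9 / 20 : ℝ) (11 / 20), ∀ U : ℝ, 0 ≤ U →
      ((11 / 20 - s) * ((-0.3051404788 : ℝ) + (-6615 / 2048) * n₁) + (s - (9 / 20)) * ((-0.3341271860 : ℝ) + (-13833 / 4096) * n₁)) / (11 / 20 - (9 / 20)) ≤
        energyDensityTT' 1 s U n₁ :=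
  floor_on_cell_of_tPrime_end_rows 1 hn0 hn2 (by norm_num)
    (fun _ hU => fermiSeaTangentRow_tPrime_nine_div_twenty_at_one_div_four hU hn0 hn2)
    (fun _ hU => fermiSeaTangentRow_tPrime_eleven_div_twenty_at_one_div_four hU hn0 hn2)

/-- **Dilute floor on `t′ ∈ [9/20, 11/20]`, rows touching `3/10`** (any density `0 ≤ n₁ < 2`, every `U ≥ 0`): the `t′`-chord of the two PREMISE-FREE kernel
Fermi-sea tangent rows `fermiSeaTangentRow_tPrime_nine_div_twenty_at_three_div_ten` and `fermiSeaTangentRow_tPrime_eleven_div_twenty_at_three_div_ten` (`HubbardFermiSeaTangentRowsDiluteEDopedImage*`, this seat g32; floors at `n₁ = 3/10`: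
-1.2632386 ∣ -1.3351872). [cite: LiebLoss1993, §8, Theorem 8.2] [cite: Ruelle1969, §3.3] -/
theorem edf_dilute3o10_p45p55 {n₁ : ℝ} (hn0 : 0 ≤ n₁) (hn2 : n₁ < 2) :
    ∀ s ∈ Icc (9 / 20 : ℝ) (11 / 20), ∀ U : ℝ, 0 ≤ U →
      ((11 / 20 - s) * ((-0.4216858292 : ℝ) + (-5745 / 2048) * n₁) + (s - (9 / 20)) * ((-0.4629459756 : ℝ) + (-11909 / 4096) * n₁)) / (11 / 20 - (9 / 20)) ≤
        energyDensityTT' 1 s U n₁ :=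
  floor_on_cell_of_tPrime_end_rows 1 hn0 hn2 (by norm_num)
    (fun _ hU => fermiSeaTangentRow_tPrime_nine_div_twenty_at_three_div_ten hU hn0 hn2)
    (fun _ hU => fermiSeaTangentRow_tPrime_eleven_div_twenty_at_three_div_ten hU hn0 hn2)

/-- **Dilute floor on `t′ ∈ [9/20, 11/20]`, rows touching `2/5`** (any density `0 ≤ n₁ < 2`, every `U ≥ 0`): the `t′`-chord of the two PREMISE-FREE kernel
Fermi-sea tangent rows `fermiSeaTangentRow_tPrime_nine_div_twenty_at_two_div_five` and `fermiSeaTangentRow_tPrime_eleven_div_twenty_at_two_div_five` (`HubbardFermiSeaTangentRowsDiluteEDopedImage*`, this seat g32; floors at `n₁ = 2/5`: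
-1.5029324 ∣ -1.5815509). [cite: LiebLoss1993, §8, Theorem 8.2] [cite: Ruelle1969, §3.3] -/
theorem edf_dilute2o5_p45p55 {n₁ : ℝ} (hn0 : 0 ≤ n₁) (hn2 : n₁ < 2) :
    ∀ s ∈ Icc (9 / 20 : ℝ) (11 / 20), ∀ U : ℝ, 0 ≤ U →
      ((11 / 20 - s) * ((-0.7153346789 : ℝ) + (-8065 / 4096) * n₁) + (s - (9 / 20)) * ((-0.7484453551 : ℝ) + (-8531 / 4096) * n₁)) / (11 / 20 - (9 / 20)) ≤
        energyDensityTT' 1 s U n₁ :=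
  floor_on_cell_of_tPrime_end_rows 1 hn0 hn2 (by norm_num)
    (fun _ hU => fermiSeaTangentRow_tPrime_nine_div_twenty_at_two_div_five hU hn0 hn2)
    (fun _ hU => fermiSeaTangentRow_tPrime_eleven_div_twenty_at_two_div_five hU hn0 hn2)

/-- **Dilute floor on `t′ ∈ [9/20, 11/20]`, rows touching `9/20`** (any density `0 ≤ n₁ < 2`, every `U ≥ 0`): the `t′`-chord of the two PREMISE-FREE kernel
Fermi-sea tangent rows `fermiSeaTangentRow_tPrime_nine_div_twenty_at_nine_div_twenty` and `fermiSeaTangentRow_tPrime_eleven_div_twenty_at_nine_div_twenty` (`HubbardFermiSeaTangentRowsDiluteEDopedImage*`, this seat g32; floors at `n₁ = 9/20`: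
-1.5948210 ∣ -1.6746444). [cite: LiebLoss1993, §8, Theorem 8.2] [cite: Ruelle1969, §3.3] -/
theorem edf_dilute9o20_p45p55 {n₁ : ℝ} (hn0 : 0 ≤ n₁) (hn2 : n₁ < 2) :
    ∀ s ∈ Icc (9 / 20 : ℝ) (11 / 20), ∀ U : ℝ, 0 ≤ U →
      ((11 / 20 - s) * ((-0.8489591108 : ℝ) + (-6789 / 4096) * n₁) + (s - (9 / 20)) * ((-0.9199934897 : ℝ) + (-6869 / 4096) * n₁)) / (11 / 20 - (9 / 20)) ≤
        energyDensityTT' 1 s U n₁ :=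
  floor_on_cell_of_tPrime_end_rows 1 hn0 hn2 (by norm_num)
    (fun _ hU => fermiSeaTangentRow_tPrime_nine_div_twenty_at_nine_div_twenty hU hn0 hn2)
    (fun _ hU => fermiSeaTangentRow_tPrime_eleven_div_twenty_at_nine_div_twenty hU hn0 hn2)

/-- **Dilute floor on `t′ ∈ [11/20, 13/20]`, rows touching `1/5`** (any density `0 ≤ n₁ < 2`, every `U ≥ 0`): the `t′`-chord of the two PREMISE-FREE kernel
Fermi-sea tangent rows `fermiSeaTangentRow_tPrime_eleven_div_twenty_at_one_div_five` and `fermiSeaTangentRow_tPrime_thirteen_div_twenty_at_one_div_five` (`HubbardFermiSeaTangentRowsDiluteEDopedImage*`, this seat g32; floors at `n₁ = 1/5`: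
-0.9979019 ∣ -1.0554470). [cite: LiebLoss1993, §8, Theorem 8.2] [cite: Ruelle1969, §3.3] -/
theorem edf_dilute1o5_p55p65 {n₁ : ℝ} (hn0 : 0 ≤ n₁) (hn2 : n₁ < 2) :
    ∀ s ∈ Icc (11 / 20 : ℝ) (13 / 20), ∀ U : ℝ, 0 ≤ U →
      ((13 / 20 - s) * ((-0.2281264663 : ℝ) + (-15765 / 4096) * n₁) + (s - (11 / 20)) * ((-0.2423610471 : ℝ) + (-4163 / 1024) * n₁)) / (13 / 20 - (11 / 20)) ≤
        energyDensityTT' 1 s U n₁ :=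
  floor_on_cell_of_tPrime_end_rows 1 hn0 hn2 (by norm_num)
    (fun _ hU => fermiSeaTangentRow_tPrime_eleven_div_twenty_at_one_div_five hU hn0 hn2)
    (fun _ hU => fermiSeaTangentRow_tPrime_thirteen_div_twenty_at_one_div_five hU hn0 hn2)

/-- **Dilute floor on `t′ ∈ [11/20, 13/20]`, rows touching `1/4`** (any density `0 ≤ n₁ < 2`, every `U ≥ 0`): the `t′`-chord of the two PREMISE-FREE kernel
Fermi-sea tangent rows `fermiSeaTangentRow_tPrime_eleven_div_twenty_at_one_div_four` and `fermiSeaTangentRow_tPrime_thirteen_div_twenty_at_one_div_four` (`HubbardFermiSeaTangentRowsDiluteEDopedImage*`, this seat g32; floors at `n₁ = 1/4`: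
-1.1784266 ∣ -1.2442002). [cite: LiebLoss1993, §8, Theorem 8.2] [cite: Ruelle1969, §3.3] -/
theorem edf_dilute1o4_p55p65 {n₁ : ℝ} (hn0 : 0 ≤ n₁) (hn2 : n₁ < 2) :
    ∀ s ∈ Icc (11 / 20 : ℝ) (13 / 20), ∀ U : ℝ, 0 ≤ U →
      ((13 / 20 - s) * ((-0.3341271860 : ℝ) + (-13833 / 4096) * n₁) + (s - (11 / 20)) * ((-0.3645615222 : ℝ) + (-3603 / 1024) * n₁)) / (13 / 20 - (11 / 20)) ≤
        energyDensityTT' 1 s U n₁ :=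
  floor_on_cell_of_tPrime_end_rows 1 hn0 hn2 (by norm_num)
    (fun _ hU => fermiSeaTangentRow_tPrime_eleven_div_twenty_at_one_div_four hU hn0 hn2)
    (fun _ hU => fermiSeaTangentRow_tPrime_thirteen_div_twenty_at_one_div_four hU hn0 hn2)

/-- **Dilute floor on `t′ ∈ [11/20, 13/20]`, rows touching `3/10`** (any density `0 ≤ n₁ < 2`, every `U ≥ 0`): the `t′`-chord of the two PREMISE-FREE kernel
Fermi-sea tangent rows `fermiSeaTangentRow_tPrime_eleven_div_twenty_at_three_div_ten` and `fermiSeaTangentRow_tPrime_thirteen_div_twenty_at_three_div_ten` (`HubbardFermiSeaTangentRowsDiluteEDopedImage*`, this seat g32; floors at `n₁ = 3/10`: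
-1.3351872 ∣ -1.4069099). [cite: LiebLoss1993, §8, Theorem 8.2] [cite: Ruelle1969, §3.3] -/
theorem edf_dilute3o10_p55p65 {n₁ : ℝ} (hn0 : 0 ≤ n₁) (hn2 : n₁ < 2) :
    ∀ s ∈ Icc (11 / 20 : ℝ) (13 / 20), ∀ U : ℝ, 0 ≤ U →
      ((13 / 20 - s) * ((-0.4629459756 : ℝ) + (-11909 / 4096) * n₁) + (s - (11 / 20)) * ((-0.5118171116 : ℝ) + (-12221 / 4096) * n₁)) / (13 / 20 - (11 / 20)) ≤
        energyDensityTT' 1 s U n₁ :=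
  floor_on_cell_of_tPrime_end_rows 1 hn0 hn2 (by norm_num)
    (fun _ hU => fermiSeaTangentRow_tPrime_eleven_div_twenty_at_three_div_ten hU hn0 hn2)
    (fun _ hU => fermiSeaTangentRow_tPrime_thirteen_div_twenty_at_three_div_ten hU hn0 hn2)

/-- **Dilute floor on `t′ ∈ [11/20, 13/20]`, rows touching `2/5`** (any density `0 ≤ n₁ < 2`, every `U ≥ 0`): the `t′`-chord of the two PREMISE-FREE kernel
Fermi-sea tangent rows `fermiSeaTangentRow_tPrime_eleven_div_twenty_at_two_div_five` and `fermiSeaTangentRow_tPrime_thirteen_div_twenty_at_two_div_five` (`HubbardFermiSeaTangentRowsDiluteEDopedImage*`, this seat g32; floors at `n₁ = 2/5`: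
-1.5815509 ∣ -1.6605090). [cite: LiebLoss1993, §8, Theorem 8.2] [cite: Ruelle1969, §3.3] -/
theorem edf_dilute2o5_p55p65 {n₁ : ℝ} (hn0 : 0 ≤ n₁) (hn2 : n₁ < 2) :
    ∀ s ∈ Icc (11 / 20 : ℝ) (13 / 20), ∀ U : ℝ, 0 ≤ U →
      ((13 / 20 - s) * ((-0.7484453551 : ℝ) + (-8531 / 4096) * n₁) + (s - (11 / 20)) * ((-0.8085558322 : ℝ) + (-2181 / 1024) * n₁)) / (13 / 20 - (11 / 20)) ≤
        energyDensityTT' 1 s U n₁ :=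
  floor_on_cell_of_tPrime_end_rows 1 hn0 hn2 (by norm_num)
    (fun _ hU => fermiSeaTangentRow_tPrime_eleven_div_twenty_at_two_div_five hU hn0 hn2)
    (fun _ hU => fermiSeaTangentRow_tPrime_thirteen_div_twenty_at_two_div_five hU hn0 hn2)

/-- **Dilute floor on `t′ ∈ [11/20, 13/20]`, rows touching `9/20`** (any density `0 ≤ n₁ < 2`, every `U ≥ 0`): the `t′`-chord of the two PREMISE-FREE kernel
Fermi-sea tangent rows `fermiSeaTangentRow_tPrime_eleven_div_twenty_at_nine_div_twenty` and `fermiSeaTangentRow_tPrime_thirteen_div_twenty_at_nine_div_twenty` (`HubbardFermiSeaTangentRowsDiluteEDopedImage*`, this seat g32; floors at `n₁ = 9/20`: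
-1.6746444 ∣ -1.7546071). [cite: LiebLoss1993, §8, Theorem 8.2] [cite: Ruelle1969, §3.3] -/
theorem edf_dilute9o20_p55p65 {n₁ : ℝ} (hn0 : 0 ≤ n₁) (hn2 : n₁ < 2) :
    ∀ s ∈ Icc (11 / 20 : ℝ) (13 / 20), ∀ U : ℝ, 0 ≤ U →
      ((13 / 20 - s) * ((-0.9199934897 : ℝ) + (-6869 / 4096) * n₁) + (s - (11 / 20)) * ((-0.9850147252 : ℝ) + (-7005 / 4096) * n₁)) / (13 / 20 - (11 / 20)) ≤
        energyDensityTT' 1 s U n₁ :=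
  floor_on_cell_of_tPrime_end_rows 1 hn0 hn2 (by norm_num)
    (fun _ hU => fermiSeaTangentRow_tPrime_eleven_div_twenty_at_nine_div_twenty hU hn0 hn2)
    (fun _ hU => fermiSeaTangentRow_tPrime_thirteen_div_twenty_at_nine_div_twenty hU hn0 hn2)

/-! ## §2 The FREE half-filled column on the two segments, read at ANY `U₀ ≥ 0` (premise-free kernel rows touching at `n₀ = 1`) -/

/-- **The FREE half-filled-band column on `t′ ∈ [9/20, 11/20]`, read at ANY `U₀ ≥ 0`** — PREMISE-FREE: `t′`-chord of the kernel rows `fermiSeaTangentRow_tPrime_nine_div_twenty_at_one`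
(`e(1, 9/20, U, 1) ≥ -1.7063872972`) and `fermiSeaTangentRow_tPrime_eleven_div_twenty_at_one` (`≥ -1.7401558855`); the rows hold at every `U ≥ 0` (the repulsion only raises `e`):
`-1.5544286495… + (-0.3376858838…)·s ≤ e(1, s, U₀, 1)`. [cite: LiebLoss1993, §8, Theorem 8.2] [cite: Ruelle1969, §3.3] [cite: Israel1979, Thm. I.3.4] [cite: Ruelle1969, §3.3] -/
theorem edf_n1_col0_p45p55_atU {U₀ : ℝ} (hU₀ : 0 ≤ U₀) :
    ∀ s ∈ Icc (9 / 20 : ℝ) (11 / 20), ((-24870858391/16000000000 : ℚ) : ℝ) + ((-270148707/800000000 : ℚ) : ℝ) * s ≤ energyDensityTT' 1 s U₀ 1 := by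
  intro s hs
  have ka : ((-13651098377/8000000000 : ℚ) : ℝ) ≤ energyDensityTT' 1 (9 / 20) U₀ 1 := by
    have h := fermiSeaTangentRow_tPrime_nine_div_twenty_at_one hU₀ zero_le_one one_lt_two
    exact le_trans (le_of_eq (by norm_num)) h
  have kb : ((-3480311771/2000000000 : ℚ) : ℝ) ≤ energyDensityTT' 1 (11 / 20) U₀ 1 := by
    have h := fermiSeaTangentRow_tPrime_eleven_div_twenty_at_one hU₀ zero_le_one one_lt_two
    exact le_trans (le_of_eq (by norm_num)) h
  have h := energyDensityTT'_tchord_floor_of_mem_Icc 1 hU₀ (n := 1) (by norm_num) (by norm_num)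
    (s₁ := 9 / 20) (s₂ := 11 / 20) (by norm_num) ka kb hs
  exact le_trans (le_of_eq (by push_cast; ring)) h

/-- **The FREE half-filled-band column on `t′ ∈ [11/20, 13/20]`, read at ANY `U₀ ≥ 0`** — PREMISE-FREE: `t′`-chord of the kernel rows `fermiSeaTangentRow_tPrime_eleven_div_twenty_at_one`
(`e(1, 11/20, U, 1) ≥ -1.7401558855`) and `fermiSeaTangentRow_tPrime_thirteen_div_twenty_at_one` (`≥ -1.7785197135`); the rows hold at every `U ≥ 0` (the repulsion only raises `e`):
`-1.5291548315… + (-0.3836382800…)·s ≤ e(1, s, U₀, 1)`. [cite: LiebLoss1993, §8, Theorem 8.2] [cite: Ruelle1969, §3.3] [cite: Israel1979, Thm. I.3.4] [cite: Ruelle1969, §3.3] -/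
theorem edf_n1_col0_p55p65_atU {U₀ : ℝ} (hU₀ : 0 ≤ U₀) :
    ∀ s ∈ Icc (11 / 20 : ℝ) (13 / 20), ((-3058309663/2000000000 : ℚ) : ℝ) + ((-9590957/25000000 : ℚ) : ℝ) * s ≤ energyDensityTT' 1 s U₀ 1 := by
  intro s hs
  have ka : ((-3480311771/2000000000 : ℚ) : ℝ) ≤ energyDensityTT' 1 (11 / 20) U₀ 1 := by
    have h := fermiSeaTangentRow_tPrime_eleven_div_twenty_at_one hU₀ zero_le_one one_lt_two
    exact le_trans (le_of_eq (by norm_num)) h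
  have kb : ((-3557039427/2000000000 : ℚ) : ℝ) ≤ energyDensityTT' 1 (13 / 20) U₀ 1 := by
    have h := fermiSeaTangentRow_tPrime_thirteen_div_twenty_at_one hU₀ zero_le_one one_lt_two
    exact le_trans (le_of_eq (by norm_num)) h
  have h := energyDensityTT'_tchord_floor_of_mem_Icc 1 hU₀ (n := 1) (by norm_num) (by norm_num)
    (s₁ := 11 / 20) (s₂ := 13 / 20) (by norm_num) ka kb hs
  exact le_trans (le_of_eq (by push_cast; ring)) h

end Summit.Ventures.CertifiedManyBodySolver.Observables

end
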